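import Mathlib
import HarnessLib

/-!
# Rank-one deficit depth law: `diag(d) − w·p pᵀ` on a positive frame is indefinite iff `w Σ p_k²/d_k > 1`
(pub-rhpf THEORY-4 §8.9 (b), rule for fake seats; mechanism search — no RH claims)

Setting (dictionary THEOREM-informal): in ζ's bottom-`K` eigenframe the window form of ζ is
`diag(ε₁ᶻ,…,ε_Kᶻ)` with `ε_kᶻ = d k > 0`; a fake obtained from ζ by REMOVING a rank-one positive piece
`w · p pᵀ` (a missing pole, a deleted point mass, a planted zero's projector; `p k = ⟨p, v_kᶻ⟩`) has
compressed form `T_K = diag(d) − w · (p|_K)(p|_K)ᵀ`.  The sign of `T_K` is decided by ONE number, the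
secular sum `S_K = Σ_{k<K} p_k² / d_k`:

* `rankOneDeficit_nonneg`  : `w · S ≤ 1 → ∀ x, 0 ≤ Σ d_k x_k² − w (Σ p_k x_k)²`  (depth-`K` BLIND);
* `rankOneDeficit_witness` : `1 < w · S → Σ d_k x_k² − w (Σ p_k x_k)² < 0` at `x_k = p_k / d_k` (DETECTED);
so the sign depth of a rank-one-deficit fake is the first `K` with `w Σ_{k<K} ⟨p,v_kᶻ⟩²/ε_kᶻ > 1`
(monotone in `K`).  Cauchy–Schwarz (`Finset.sum_mul_sq_le_sq_mul_sq`) and one explicit witness;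
[folklore].  Decls in `…PfPersistence.RankOneDeficit`.
-/

set_option linter.dupNamespace false

noncomputable section

namespace Summit.RiemannHypothesis.RiemannHypothesis.Theorems.PfPersistence.RankOneDeficit

open Finset BigOperators

variable {ι : Type*} (s : Finset ι) (d p : ι → ℝ) (w : ℝ)

/-- The rank-one-deficit quadratic form `Σ d_k x_k² − w (Σ p_k x_k)²` on the frame `s`. -/
def deficitForm (x : ι → ℝ) : ℝ := (∑ k ∈ s, d k * x k ^ 2) - w * (∑ k ∈ s, p k * x k) ^ 2

/-- The secular sum `S = Σ p_k² / d_k`. -/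
def secularSum : ℝ := ∑ k ∈ s, p k ^ 2 / d k

/-- Cauchy–Schwarz in the `d`-metric: `(Σ p x)² ≤ (Σ p²/d)(Σ d x²)` for `d > 0`. -/
theorem sq_sum_le_secular_mul_energy (hd : ∀ k ∈ s, 0 < d k) (x : ι → ℝ) :
    (∑ k ∈ s, p k * x k) ^ 2 ≤ secularSum s d p * ∑ k ∈ s, d k * x k ^ 2 := by
  have key := Finset.sum_mul_sq_le_sq_mul_sq s (fun k => p k / Real.sqrt (d k))
    (fun k => Real.sqrt (d k) * x k)
  have h1 : ∑ k ∈ s, p k / Real.sqrt (d k) * (Real.sqrt (d k) * x k) = ∑ k ∈ s, p k * x k := by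
    refine Finset.sum_congr rfl fun k hk => ?_
    have hs : Real.sqrt (d k) ≠ 0 := (Real.sqrt_pos.mpr (hd k hk)).ne'
    field_simp
  have h2 : ∑ k ∈ s, (p k / Real.sqrt (d k)) ^ 2 = secularSum s d p := by
    refine Finset.sum_congr rfl fun k hk => ?_
    rw [div_pow, Real.sq_sqrt (hd k hk).le]
  have h3 : ∑ k ∈ s, (Real.sqrt (d k) * x k) ^ 2 = ∑ k ∈ s, d k * x k ^ 2 := by
    refine Finset.sum_congr rfl fun k hk => ?_
    rw [mul_pow, Real.sq_sqrt (hd k hk).le]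
  rw [h1, h2, h3] at key
  exact key

/-- BLIND: if `w · S ≤ 1` (and `w ≥ 0`) the deficit form is non-negative on the whole frame. -/
theorem rankOneDeficit_nonneg (hd : ∀ k ∈ s, 0 < d k) (hw : 0 ≤ w)
    (hS : w * secularSum s d p ≤ 1) (x : ι → ℝ) : 0 ≤ deficitForm s d p w x := by
  unfold deficitForm
  have hE : 0 ≤ ∑ k ∈ s, d k * x k ^ 2 :=
    Finset.sum_nonneg fun k hk => mul_nonneg (hd k hk).le (sq_nonneg _)
  have hcs := sq_sum_le_secular_mul_energy s d p hd x
  have : w * (∑ k ∈ s, p k * x k) ^ 2 ≤ ∑ k ∈ s, d k * x k ^ 2 := by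
    calc w * (∑ k ∈ s, p k * x k) ^ 2
        ≤ w * (secularSum s d p * ∑ k ∈ s, d k * x k ^ 2) :=
          mul_le_mul_of_nonneg_left hcs hw
      _ = (w * secularSum s d p) * ∑ k ∈ s, d k * x k ^ 2 := by ring
      _ ≤ 1 * ∑ k ∈ s, d k * x k ^ 2 := mul_le_mul_of_nonneg_right hS hE
      _ = ∑ k ∈ s, d k * x k ^ 2 := one_mul _
  linarith

/-- The value of the deficit form at the secular witness `x_k = p_k / d_k` is `S (1 − w S)`. -/
theorem deficitForm_witness (hd : ∀ k ∈ s, 0 < d k) :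
    deficitForm s d p w (fun k => p k / d k) = secularSum s d p * (1 - w * secularSum s d p) := by
  unfold deficitForm secularSum
  have h1 : ∑ k ∈ s, d k * (p k / d k) ^ 2 = ∑ k ∈ s, p k ^ 2 / d k := by
    refine Finset.sum_congr rfl fun k hk => ?_
    have : d k ≠ 0 := (hd k hk).ne'
    field_simp
  have h2 : ∑ k ∈ s, p k * (p k / d k) = ∑ k ∈ s, p k ^ 2 / d k := by
    refine Finset.sum_congr rfl fun k hk => ?_
    have : d k ≠ 0 := (hd k hk).ne'
    field_simp
  rw [h1, h2]; ring

/-- DETECTED: if `1 < w · S` the secular witness is strictly negative for the deficit form. -/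
theorem rankOneDeficit_witness (hd : ∀ k ∈ s, 0 < d k) (hS : 1 < w * secularSum s d p) :
    deficitForm s d p w (fun k => p k / d k) < 0 := by
  rw [deficitForm_witness s d p w hd]
  have hS0 : 0 ≤ secularSum s d p :=
    Finset.sum_nonneg fun k hk => div_nonneg (sq_nonneg _) (hd k hk).le
  have hSpos : 0 < secularSum s d p := by
    rcases lt_or_ge 0 (secularSum s d p) with h | h
    · exact h
    · exfalso
      have h0 : secularSum s d p = 0 := le_antisymm h hS0
      rw [h0, mul_zero] at hS
      linarith
  have : 1 - w * secularSum s d p < 0 := by linarith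
  exact mul_neg_of_pos_of_neg hSpos this

/-- Dichotomy packaged: the deficit form is non-negative on the frame iff `w S ≤ 1` (for `w ≥ 0`). -/
theorem rankOneDeficit_nonneg_iff (hd : ∀ k ∈ s, 0 < d k) (hw : 0 ≤ w) :
    (∀ x, 0 ≤ deficitForm s d p w x) ↔ w * secularSum s d p ≤ 1 := by
  constructor
  · intro h
    rcases le_or_gt (w * secularSum s d p) 1 with hle | hlt
    · exact hle
    · exfalso
      have := rankOneDeficit_witness s d p w hd hlt
      linarith [h (fun k => p k / d k)]
  · intro hS x
    exact rankOneDeficit_nonneg s d p w hd hw hS x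

/-- MONOTONICITY of the secular sum in the frame: enlarging the frame can only increase `S`,
so detection (`1 < w S`) persists to every deeper frame and blindness holds on every shallower one. -/
theorem secularSum_mono {s t : Finset ι} (hst : s ⊆ t) (hd : ∀ k ∈ t, 0 < d k) :
    secularSum s d p ≤ secularSum t d p :=
  Finset.sum_le_sum_of_subset_of_nonneg hst fun k hk _ => div_nonneg (sq_nonneg _) (hd k hk).le

end Summit.RiemannHypothesis.RiemannHypothesis.Theorems.PfPersistence.RankOneDeficit

end
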